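import Literature.NumberTheory.Automorphic.HeckeAlgebra
import Mathlib.RingTheory.MvPolynomial.Symmetric.Defs
import Mathlib.Analysis.Complex.Basic
import HarnessLib

/-!
# Hecke operators under group automorphisms and central translations; `e_i(α⁻¹)`

Topic `NumberTheory/Automorphic`. Proofs-only support file (theorems, no definitions, no named
facts), fourth of the series `CuspidalContragredient{Involution, Arch, Forms, Hecke, Proofs}`
discharging `CuspidalAutomorphicRepData.exists_contragredient_satake` (`CuspidalContragredient`);
this file is generic (a group `G`, a subgroup `U`, a representation `ρ`; the tree's
`heckeOperator ρ U t = ∑_{yU ⊆ UtU} ρ(y)` of `HeckeAlgebra`).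

* `heckeOperator_apply_of_semiconj_mulEquiv` — for an automorphism `e` of `G` with `e(U) = U` and a
  linear `P` with `ρ(y) P = P ρ(e y)` (e.g. `P φ = φ ∘ e` for right translation of functions),
  `[UtU] (P v) = P ([U e(t) U] v)` on `U`-fixed `v` (a transversal of `UtU/U` is carried by `e` to a
  transversal of `U e(t) U/U`; both sides are the junk value `0` for infinite double cosets).
* `heckeOperator_center_mul_apply` — `[U zt U] v = ρ(z) ([UtU] v)` for central `z`.
* `satakeEigenvalue_map_inv` — `q^{i(n-i)} e_i(α⁻¹) = q^{(n-i)(n-(n-i))} e_{n-i}(α) e_n(α)⁻¹` for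
  `#α = n`, `e_n(α) ≠ 0`, `i ≤ n` (the Satake–Tamagawa eigenvalues of the inverse parameter; from
  `e_i(α⁻¹) ∏α = e_{n-i}(α)`, re-proved privately from `LanglandsTetrahedralProofs` to keep the
  imports short).

## References

* J. W. Cogdell, *Analytic theory of L-functions for GL_n*, in: An Introduction to the Langlands
  Program, Birkhäuser 2004, §2. [CogdellAnalyticTheory2004]
* C. Bushnell, G. Henniart, *The local Langlands conjecture for GL(2)*, Springer 2006, §4.1.
  [BushnellHenniart2006]
-/

noncomputable section

open scoped Classical

namespace Literature.NumberTheory.Automorphic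

/-! ### Hecke operators under automorphisms and central translations (generic) -/

section HeckeTransport

variable {k G V : Type*} [CommRing k] [Group G] [AddCommGroup V] [Module k V]
  (ρ : Representation k G V) (U : Subgroup G)

/-- If the orbit `U · tU ⊆ G ⧸ U` (i.e. `UtU/U`) is infinite, the (junk) Hecke operator `[UtU]`
vanishes: every summand `ρ(y)` is invertible, hence non-zero on a non-trivial `V`, so the `finsum`
has infinite support. (Private copy of the 12-line junk-case lemma of `JacquetLanglandsParts` /
`AutomorphicGaloisConj`, to keep the import list short; librarian: all copies belong next to
`heckeOperator` in `HeckeAlgebra`.) [folklore] -/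
private theorem heckeOperator_eq_zero_of_infinite_orbit (t : G)
    (hU : (MulAction.orbit U (t : G ⧸ U)).Infinite) : heckeOperator ρ U t = 0 := by
  rcases subsingleton_or_nontrivial V with hV | hV
  · exact LinearMap.ext fun v => Subsingleton.elim _ _
  rw [heckeOperator]
  apply finsum_mem_eq_zero_of_infinite
  rw [Set.inter_eq_self_of_subset_left]
  · exact hU
  · intro y _
    rw [Function.mem_support]
    intro h0
    obtain ⟨w, hw⟩ := exists_ne (0 : V)
    apply hw
    have : ρ y.out w = 0 := by rw [h0, LinearMap.zero_apply]
    simpa using congrArg (ρ y.out⁻¹) this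

/-- A finite double coset `UtU/U` has a transversal: a finite set `s ⊆ G` mapped bijectively onto
the orbit `U · tU` by `x ↦ xU`. [folklore] -/
theorem exists_finset_bijOn_orbit_of_finite (t : G) (hfin : (MulAction.orbit U (t : G ⧸ U)).Finite) :
    ∃ s : Finset G, Set.BijOn (fun x : G => (x : G ⧸ U)) s (MulAction.orbit U (t : G ⧸ U)) := by
  classical
  refine ⟨hfin.toFinset.image Quotient.out, ?_, ?_, ?_⟩
  · intro x hx
    obtain ⟨y, hy, rfl⟩ := Finset.mem_image.1 hx
    rw [Set.Finite.mem_toFinset] at hy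
    simpa only [QuotientGroup.out_eq'] using hy
  · intro x hx x' hx' h
    obtain ⟨y, -, rfl⟩ := Finset.mem_image.1 hx
    obtain ⟨y', -, rfl⟩ := Finset.mem_image.1 hx'
    simp only [QuotientGroup.out_eq'] at h
    rw [h]
  · intro y hy
    refine ⟨y.out, Finset.mem_image.2 ⟨y, (Set.Finite.mem_toFinset _).2 hy, rfl⟩, ?_⟩
    exact QuotientGroup.out_eq' y

/-- **Transport of transversals.** Let `Θ : G ⧸ U → G ⧸ U` be injective and covered by a map
`f : G → G` (`(f x)U = Θ (xU)`). If `s` is a transversal of the orbit `U · c` then `f(s)` is a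
transversal of `Θ(U · c)`. [folklore] -/
theorem bijOn_image_of_bijOn_coe {Θ : G ⧸ U → G ⧸ U} (hΘ : Function.Injective Θ) {f : G → G}
    (hmk : ∀ x : G, ((f x : G) : G ⧸ U) = Θ (x : G ⧸ U)) {s : Finset G}
    {c : G ⧸ U} (hs : Set.BijOn (fun x : G => (x : G ⧸ U)) s (MulAction.orbit U c)) :
    Set.BijOn (fun x : G => (x : G ⧸ U)) (s.image f) (Θ '' MulAction.orbit U c) := by
  classical
  rw [← hs.image_eq, Finset.coe_image, Set.image_image]
  refine ⟨?_, ?_, ?_⟩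
  · rintro _ ⟨x, hx, rfl⟩
    exact ⟨x, hx, (hmk x).symm⟩
  · rintro _ ⟨x, hx, rfl⟩ _ ⟨x', hx', rfl⟩ h
    change ((f x : G) : G ⧸ U) = ((f x' : G) : G ⧸ U) at h
    rw [hmk, hmk] at h
    rw [hs.injOn hx hx' (hΘ h)]
  · rintro _ ⟨x, hx, rfl⟩
    exact ⟨f x, ⟨x, hx, rfl⟩, hmk x⟩

/-- **Hecke operators under a group automorphism.** Let `e` be an automorphism of `G` preserving
`U`, and `P : V → V` a linear map intertwining `ρ(y) ∘ P = P ∘ ρ(e y)` (e.g. `P φ = φ ∘ e` for right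
translation on functions). Then on `U`-fixed vectors `[UtU] (P v) = P ([U e(t) U] v)`: the
transversal `s` of `UtU/U` is carried by `e` to a transversal of `U e(t) U / U`; both sides vanish
when the double cosets are infinite. (Cogdell 2004, §2: the Hecke algebra acts on `φ ∘ ι` through
`ι`.) [folklore] -/
theorem heckeOperator_apply_of_semiconj_mulEquiv (e : G ≃* G) (hU : ∀ g, e g ∈ U ↔ g ∈ U)
    (P : V →ₗ[k] V) (hP : ∀ (y : G) (w : V), ρ y (P w) = P (ρ (e y) w)) (t : G) {v : V}
    (hv : v ∈ ρ.fixedPoints U) :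
    heckeOperator ρ U t (P v) = P (heckeOperator ρ U (e t) v) := by
  classical
  -- the induced bijection of `G ⧸ U`
  let Θ : G ⧸ U → G ⧸ U := Quotient.map' e fun a b h => by
    rw [QuotientGroup.leftRel_apply] at h ⊢
    rw [← map_inv, ← map_mul]
    exact (hU _).2 h
  have hmk : ∀ x : G, ((e x : G) : G ⧸ U) = Θ (x : G ⧸ U) := fun x => rfl
  have hΘ : Function.Injective Θ := by
    intro x y
    induction x using Quotient.inductionOn' with
    | h a =>
      induction y using Quotient.inductionOn' with
      | h b =>
        intro h
        change ((e a : G) : G ⧸ U) = ((e b : G) : G ⧸ U) at h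
        change (a : G ⧸ U) = (b : G ⧸ U)
        rw [QuotientGroup.eq] at h ⊢
        rw [← map_inv, ← map_mul] at h
        exact (hU _).1 h
  have horb : MulAction.orbit U ((e t : G) : G ⧸ U) = Θ '' MulAction.orbit U (t : G ⧸ U) := by
    ext y
    constructor
    · rintro ⟨⟨u, hu⟩, rfl⟩
      refine ⟨(⟨e.symm u, (hU _).1 (by rw [e.apply_symm_apply]; exact hu)⟩ : U) • (t : G ⧸ U),
        MulAction.mem_orbit _ _, ?_⟩
      change Θ (((e.symm u * t : G)) : G ⧸ U) = (((u * e t : G)) : G ⧸ U)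
      rw [← hmk, map_mul, e.apply_symm_apply]
    · rintro ⟨_, ⟨⟨u, hu⟩, rfl⟩, rfl⟩
      refine ⟨⟨e u, (hU u).2 hu⟩, ?_⟩
      change (((e u * e t : G)) : G ⧸ U) = Θ (((u * t : G)) : G ⧸ U)
      rw [← hmk, map_mul]
  have hv' : P v ∈ ρ.fixedPoints U := by
    rw [Representation.mem_fixedPoints] at hv ⊢
    intro u hu
    rw [hP, hv _ ((hU u).2 hu)]
  by_cases hfin : (MulAction.orbit U (t : G ⧸ U)).Finite
  · obtain ⟨s, hs⟩ := exists_finset_bijOn_orbit_of_finite U t hfin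
    have hs' := bijOn_image_of_bijOn_coe U hΘ hmk hs
    rw [← horb] at hs'
    rw [heckeOperator_apply_eq_sum _ _ _ _ hs hv', heckeOperator_apply_eq_sum _ _ _ _ hs' hv, map_sum,
      Finset.sum_image fun x _ y _ h => e.injective h]
    exact Finset.sum_congr rfl fun x _ => hP x v
  · have hinf : (MulAction.orbit U (t : G ⧸ U)).Infinite := hfin
    have hinf' : (MulAction.orbit U ((e t : G) : G ⧸ U)).Infinite := by
      rw [horb]
      exact hinf.image hΘ.injOn
    rw [heckeOperator_eq_zero_of_infinite_orbit ρ U _ hinf,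
      heckeOperator_eq_zero_of_infinite_orbit ρ U _ hinf', LinearMap.zero_apply, LinearMap.zero_apply,
      map_zero]

/-- **Hecke operators of central translates.** For `z` in the centre of `G` and a `U`-fixed `v`,
`[U (z t) U] v = ρ(z) ([U t U] v)`: left multiplication by `z` carries a transversal of `UtU/U`
to one of `U z t U / U = z · UtU/U`. [folklore] -/
theorem heckeOperator_center_mul_apply {z : G} (hz : z ∈ Subgroup.center G) (t : G) {v : V}
    (hv : v ∈ ρ.fixedPoints U) :
    heckeOperator ρ U (z * t) v = ρ z (heckeOperator ρ U t v) := by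
  classical
  let Θ : G ⧸ U → G ⧸ U := fun c => z • c
  have hmk : ∀ x : G, (((z * x : G)) : G ⧸ U) = Θ (x : G ⧸ U) := fun x => rfl
  have hΘ : Function.Injective Θ := MulAction.injective z
  have hzc : ∀ g : G, g * z = z * g := fun g => (Subgroup.mem_center_iff.1 hz g)
  have horb : MulAction.orbit U (((z * t : G)) : G ⧸ U) = Θ '' MulAction.orbit U (t : G ⧸ U) := by
    ext y
    constructor
    · rintro ⟨⟨u, hu⟩, rfl⟩
      refine ⟨(⟨u, hu⟩ : U) • (t : G ⧸ U), MulAction.mem_orbit _ _, ?_⟩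
      change ((((z * (u * t)) : G)) : G ⧸ U) = (((u * (z * t) : G)) : G ⧸ U)
      rw [← mul_assoc, ← hzc u, mul_assoc]
    · rintro ⟨_, ⟨⟨u, hu⟩, rfl⟩, rfl⟩
      refine ⟨⟨u, hu⟩, ?_⟩
      change (((u * (z * t) : G)) : G ⧸ U) = (((z * (u * t) : G)) : G ⧸ U)
      rw [← mul_assoc, hzc u, mul_assoc]
  by_cases hfin : (MulAction.orbit U (t : G ⧸ U)).Finite
  · obtain ⟨s, hs⟩ := exists_finset_bijOn_orbit_of_finite U t hfin
    have hs' := bijOn_image_of_bijOn_coe U hΘ hmk hs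
    rw [← horb] at hs'
    rw [heckeOperator_apply_eq_sum _ _ _ _ hs hv, heckeOperator_apply_eq_sum _ _ _ _ hs' hv, map_sum,
      Finset.sum_image fun x _ y _ h => mul_right_injective z h]
    exact Finset.sum_congr rfl fun x _ => by rw [map_mul, Module.End.mul_apply]
  · have hinf : (MulAction.orbit U (t : G ⧸ U)).Infinite := hfin
    have hinf' : (MulAction.orbit U (((z * t : G)) : G ⧸ U)).Infinite := by
      rw [horb]
      exact hinf.image hΘ.injOn
    rw [heckeOperator_eq_zero_of_infinite_orbit ρ U _ hinf,
      heckeOperator_eq_zero_of_infinite_orbit ρ U _ hinf', LinearMap.zero_apply, map_zero]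

end HeckeTransport

/-! ### Elementary symmetric functions of the inverses -/

section Esymm

/-- `e_{j+1}(a :: s) = e_{j+1}(s) + a e_j(s)`. [folklore] -/
private theorem esymm_cons_succ' (a : ℂ) (s : Multiset ℂ) (j : ℕ) :
    (a ::ₘ s).esymm (j + 1) = s.esymm (j + 1) + a * s.esymm j := by
  simp only [Multiset.esymm, Multiset.powersetCard_cons, Multiset.map_add, Multiset.sum_add,
    Multiset.map_map, Function.comp_def, Multiset.prod_cons]
  rw [← Multiset.sum_map_mul_left]

/-- **Elementary symmetric functions of the inverses**: `e_j(s⁻¹) · ∏ s = e_l(s)` whenever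
`j + l = #s` and `0 ∉ s` (the coefficients of the reciprocal polynomial). Same statement as
`esymm_map_inv_mul_prod` of `LanglandsTetrahedralProofs`, re-proved privately to keep the import
list short. [folklore] -/
private theorem esymm_map_inv_mul_prod' (s : Multiset ℂ) (hs : ∀ a ∈ s, a ≠ 0) {j l : ℕ}
    (hjl : j + l = Multiset.card s) :
    (s.map (·⁻¹)).esymm j * s.prod = s.esymm l := by
  induction s using Multiset.induction_on generalizing j l with
  | empty =>
    rw [Multiset.card_zero, Nat.add_eq_zero_iff] at hjl
    obtain ⟨rfl, rfl⟩ := hjl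
    simp [Multiset.esymm]
  | cons a s ih =>
    have ha : a ≠ 0 := hs a (Multiset.mem_cons_self a s)
    have hs' : ∀ b ∈ s, b ≠ 0 := fun b hb => hs b (Multiset.mem_cons_of_mem hb)
    have hcard : ∀ t : Multiset ℂ, t.esymm (Multiset.card t) = t.prod := fun t => by
      rw [Multiset.esymm, Multiset.powersetCard_self, Multiset.map_singleton, Multiset.sum_singleton]
    have hzero : ∀ (t : Multiset ℂ) (i : ℕ), Multiset.card t < i → t.esymm i = 0 := fun t i h => by
      simp [Multiset.esymm, Multiset.powersetCard_eq_empty _ h]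
    have hzero' : ∀ t : Multiset ℂ, t.esymm 0 = 1 := fun t => by simp [Multiset.esymm]
    rw [Multiset.card_cons] at hjl
    simp only [Multiset.map_cons, Multiset.prod_cons]
    rcases j with _ | j
    · have hl : l = Multiset.card (a ::ₘ s) := by rw [Multiset.card_cons]; omega
      rw [hzero', one_mul, hl, hcard, Multiset.prod_cons]
    rcases l with _ | l
    · have h0 : (s.map (·⁻¹)).esymm (j + 1) = 0 := hzero _ _ (by rw [Multiset.card_map]; omega)
      have h1 := ih hs' (j := j) (l := 0) (by omega)
      rw [hzero'] at h1
      rw [esymm_cons_succ', h0, zero_add, hzero']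
      calc a⁻¹ * (s.map (·⁻¹)).esymm j * (a * s.prod)
          = (a⁻¹ * a) * ((s.map (·⁻¹)).esymm j * s.prod) := by ring
        _ = 1 := by rw [inv_mul_cancel₀ ha, one_mul, h1]
    · have h1 := ih hs' (j := j + 1) (l := l) (by omega)
      have h2 := ih hs' (j := j) (l := l + 1) (by omega)
      rw [esymm_cons_succ', esymm_cons_succ']
      calc ((s.map (·⁻¹)).esymm (j + 1) + a⁻¹ * (s.map (·⁻¹)).esymm j) * (a * s.prod)
          = a * ((s.map (·⁻¹)).esymm (j + 1) * s.prod)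
            + (a⁻¹ * a) * ((s.map (·⁻¹)).esymm j * s.prod) := by ring
        _ = s.esymm (l + 1) + a * s.esymm l := by
          rw [h1, h2, inv_mul_cancel₀ ha, one_mul, add_comm]

/-- The Satake–Tamagawa eigenvalues of `α⁻¹` from those of `α`: if `#α = n` and `e_n(α) ≠ 0` then
`q_v^{i(n-i)/2} e_i(α⁻¹) = q_v^{(n-i)(n-(n-i))/2} e_{n-i}(α) · e_n(α)⁻¹` for `i ≤ n`. [folklore] -/
theorem satakeEigenvalue_map_inv (q : ℂ) {α : Multiset ℂ} {m : ℕ} (hcard : Multiset.card α = m)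
    (hne : α.esymm m ≠ 0) {i : ℕ} (hi : i ≤ m) :
    q ^ (i * (m - i)) * (α.map (·⁻¹)).esymm i =
      q ^ ((m - i) * (m - (m - i))) * α.esymm (m - i) * (α.esymm m)⁻¹ := by
  have hprod : α.esymm m = α.prod := by
    rw [← hcard, Multiset.esymm, Multiset.powersetCard_self, Multiset.map_singleton, Multiset.sum_singleton]
  have h0 : ∀ a ∈ α, a ≠ 0 := by
    intro a ha ha0
    apply hne
    rw [hprod]
    exact Multiset.prod_eq_zero (ha0 ▸ ha)
  have key := esymm_map_inv_mul_prod' α h0 (j := i) (l := m - i) (by omega)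
  rw [← hprod] at key
  have hexp : (m - i) * (m - (m - i)) = i * (m - i) := by
    rw [Nat.sub_sub_self hi, Nat.mul_comm]
  rw [hexp, ← key, mul_assoc, mul_assoc, mul_inv_cancel₀ hne, mul_one]

end Esymm


end Literature.NumberTheory.Automorphic
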